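import Summits.CriticalPhenomena.PercolationContinuityZ3.Theorems.PercNearOneGluingNoHeavyQuantLawCombMixture
import Summits.CriticalPhenomena.PercolationContinuityZ3.Theorems.PercNearOneGluingNoHeavyQuantFarTreeBlockCombStrong
import HarnessLib

/-!
# QUANT lane R8, FAR on trees beyond block-combs: the law-comb in GATE COORDINATES — independent gates, a chain, and side units reading
# pairwise disjoint private gate sets through ARBITRARY local count functions; identification with `…QuantLawCombMixture` and the mixture
# principle as a FAR certificate

builds on p205010 (kernel theorem, internal audit signed; external expert review pending)

Support file (`--supports stmt-CriticalPhenomena-4575`), QUANT lane seat prim-quant-p1 (gen 10); memo `run/shared/lean/prim/quant/P1-SURPLUS.md` §21.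
Theorems only, no sorries, standard axioms.  Pattern: p1 g8's `Quant.BlockCombGate.real_heavy_eq_tail` (chain induction, conditioning on the
top chain gate) with the blob readings replaced by arbitrary local counts, whose joint law factorises by
`prodBernoulli_real_inter_biInter_of_determinedBy` (Grimmett §2.2).

**Setting.**  Independent gates `q : E → [0,1]`; a chain `ch : Fin D → E` (injective); side units `k : κ` with pairwise disjoint private gate
sets `G k ⊆ E` off the chain, levels `lv k ≤ D`, and COUNT FUNCTIONS `cnt k : Set E → ℕ` that are LOCAL (`cnt k ω` depends only on `ω ∩ G k`)
and bounded by `M k`.  Unit `k` is reached in `ω` when the chain prefix `ch 0, …, ch (lv k − 1)` lies in `ω`; the relay count is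
`N(ω) = Σ_{k reached} cnt k ω`.  Every rooted tree is of this form: the chain of the distinguished relay, `G k` = the vertex set of the `k`-th
side subtree, `cnt k ω` = the number of its relays joined to its attachment vertex inside `ω`.

* `Quant.LawCombGate.real_lawCount_eq_sum` — the joint law of the local counts is the product of their laws (block independence):
  `P(j+1 ≤ Σ_{lv k ≤ i} cnt k) = Σ_{c ∈ cfg M} (Π_k P(cnt k = c k))·𝟙[j+1 ≤ Σ_{lv k ≤ i} c k]`.
* `Quant.LawCombGate.gtail_succ` — the law-comb tail one chain gate longer.
* `Quant.LawCombGate.real_heavy_eq_gtail` — **identification**: `P(N ≥ j+1) = GTAIL[D, q ∘ ch, lv, M, (k, h) ↦ P(cnt k = h), j]`.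
* `Quant.LawCombGate.farTree_lawComb_of_mixture` — **FAR BY MIXTURE CERTIFICATE, gate coordinates**: if every unit law `h ↦ P(cnt k = h)` is
  a mixture `Σ_r λ k r·(law of a blob family)` whose genuine components (`λ k r > 0`) have gates in `[0,1]`, total size `≤ M k`, live blobs at
  levels `≤ D` with `1 − (∏_{i<lv k} q(ch i))·gt k r l ≤ t`, and a common mean `m k`, and if `2j < Σ_k (∏_{i<lv k} q(ch i))·m k`, then
  `P(N ≤ j) ≤ t` (`Quant.LawComb.tail_ge_of_mixture`).  The cherry-comb row (`…QuantFarTreeCherryComb`) is the instance with the unit-cherry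
  decomposition; further side structures need only their law-level decomposition.
[this work]; block independence [cite: Grimmett1999, §2.2]; product measure [cite: Grimmett1999, §1.3 p. 10].
-/

noncomputable section

namespace Summit.CriticalPhenomena.PercolationContinuityZ3.Theorems

namespace Quant

namespace LawCombGate

open Finset MeasureTheory
open Literature.Probability.LatticeModels
open Literature.Probability.Percolation
open scoped Classical

variable {E : Type*} [Fintype E] [DecidableEq E] {κ : Type*} [Fintype κ] [DecidableEq κ] {β : Type*} [Fintype β] [DecidableEq β]

/-- depth law of the chain -/
local notation3 "pd[" D ", " q ", " i "]" =>
  (∏ i' ∈ Finset.range (i : ℕ), (q : ℕ → ℝ) i') * (if (i : ℕ) < (D : ℕ) then 1 - (q : ℕ → ℝ) i else 1)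
/-- configurations of unit counts bounded by `M` -/
local notation3 "cfg[" M "]" => Fintype.piFinset (fun k : κ => Finset.range ((M : κ → ℕ) k + 1))
/-- the law-comb tail (canonical model of `…QuantLawCombMixture`) -/
local notation3 "GTAIL[" D ", " q ", " lv ", " M ", " μ ", " j "]" =>
  ∑ i ∈ Finset.range ((D : ℕ) + 1), pd[D, q, i] *
    ∑ c ∈ cfg[M], (∏ k, (μ : κ → ℕ → ℝ) k ((c : κ → ℕ) k)) *
      (if (j : ℕ) + 1 ≤ ∑ k ∈ Finset.univ.filter (fun k => (lv : κ → ℕ) k ≤ (i : ℕ)), (c : κ → ℕ) k then (1 : ℝ) else 0)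
/-- product weight of a set `T` of open blobs of ONE unit (blob labels `β`) -/
local notation3 "wβ[" g ", " T "]" => ∏ l, (if l ∈ (T : Finset β) then (g : β → ℝ) l else 1 - (g : β → ℝ) l)
/-- the law of a blob family -/
local notation3 "PB[" sz ", " gt ", " h "]" =>
  ∑ T : Finset β, wβ[gt, T] * (if ∑ l ∈ T, (sz : β → ℕ) l = (h : ℕ) then (1 : ℝ) else 0)

/-! ### 1. Reading the local counts -/

omit [DecidableEq E] in
/-- **Block independence of local counts.**  For pairwise disjoint gate sets `G k` and local counts `cnt k` bounded by `M k`, the probability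
that the units of level `≤ i` carry `≥ j+1` relays is `Σ_{c ∈ cfg M} (Π_k P(cnt k = c k))·𝟙[j+1 ≤ Σ_{lv k ≤ i} c k]`. [this work] -/
theorem real_lawCount_eq_sum (q : E → unitInterval) (G : κ → Finset E)
    (hGdisj : ∀ k k', k ≠ k' → Disjoint (G k) (G k')) (cnt : κ → Set E → ℕ)
    (hloc : ∀ k (ω ω' : Set E), (∀ e ∈ G k, e ∈ ω ↔ e ∈ ω') → cnt k ω = cnt k ω')
    (M : κ → ℕ) (hbd : ∀ k ω, cnt k ω ≤ M k) (lv : κ → ℕ) (i j : ℕ) :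
    (prodBernoulli q).real {ω : Set E | j + 1 ≤ ∑ k ∈ Finset.univ.filter (fun k => lv k ≤ i), cnt k ω} =
      ∑ c ∈ cfg[M], (∏ k, (prodBernoulli q).real {ω : Set E | cnt k ω = c k}) *
        (if j + 1 ≤ ∑ k ∈ Finset.univ.filter (fun k => lv k ≤ i), c k then (1 : ℝ) else 0) := by
  -- the heavy event as a disjoint union over the count configurations
  have hdec : {ω : Set E | j + 1 ≤ ∑ k ∈ Finset.univ.filter (fun k => lv k ≤ i), cnt k ω} =
      ⋃ c ∈ (cfg[M]).filter (fun c : κ → ℕ => j + 1 ≤ ∑ k ∈ Finset.univ.filter (fun k => lv k ≤ i), c k),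
        ⋂ k ∈ (Finset.univ : Finset κ), {ω : Set E | cnt k ω = c k} := by
    ext ω
    simp only [Set.mem_setOf_eq, Set.mem_iUnion, Set.mem_iInter, Finset.mem_filter, Fintype.mem_piFinset, Finset.mem_range,
      Finset.mem_univ, true_implies, exists_prop]
    constructor
    · intro h
      exact ⟨fun k => cnt k ω, ⟨fun k => Nat.lt_succ_of_le (hbd k ω), h⟩, fun k => rfl⟩
    · rintro ⟨c, ⟨-, hc⟩, hω⟩
      rw [Finset.sum_congr rfl fun k _ => hω k]
      exact hc
  have hdisj : ((cfg[M]).filter (fun c : κ → ℕ => j + 1 ≤ ∑ k ∈ Finset.univ.filter (fun k => lv k ≤ i), c k) : Set (κ → ℕ)).PairwiseDisjoint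
      (fun c => ⋂ k ∈ (Finset.univ : Finset κ), {ω : Set E | cnt k ω = c k}) := by
    intro c _ c' _ hcc'
    rw [Function.onFun, Set.disjoint_left]
    intro ω hω hω'
    simp only [Set.mem_iInter, Finset.mem_univ, true_implies, Set.mem_setOf_eq] at hω hω'
    exact hcc' (funext fun k => (hω k).symm.trans (hω' k))
  rw [hdec, measureReal_biUnion_finset hdisj (fun c _ => MeasurableSet.of_discrete), Finset.sum_filter]
  refine Finset.sum_congr rfl fun c _ => ?_
  by_cases hc : j + 1 ≤ ∑ k ∈ Finset.univ.filter (fun k => lv k ≤ i), c k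
  · rw [if_pos hc, if_pos hc, mul_one]
    -- block independence
    have hS : ((Finset.univ : Finset κ) : Set κ).PairwiseDisjoint G := fun k _ k' _ hkk' => hGdisj k k' hkk'
    have hC : ∀ k ∈ (Finset.univ : Finset κ), DeterminedBy {ω : Set E | cnt k ω = c k} (↑(G k) : Set E) := by
      intro k _
      rw [determinedBy_iff]
      intro ω ω' h
      simp only [Set.mem_setOf_eq]
      rw [hloc k ω ω' fun e he => ?_]
      constructor
      · intro heω; exact ((Set.ext_iff.1 h e).1 ⟨heω, Finset.mem_coe.2 he⟩).1
      · intro heω'; exact ((Set.ext_iff.1 h e).2 ⟨heω', Finset.mem_coe.2 he⟩).1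
    have hA : DeterminedBy (Set.univ : Set (Set E)) (⋃ k ∈ (Finset.univ : Finset κ), (↑(G k) : Set E))ᶜ := by
      rw [determinedBy_iff]; intro ω ω' _; simp
    have key := prodBernoulli_real_inter_biInter_of_determinedBy q (Finset.univ : Finset κ) G hS hC
      (fun k _ => MeasurableSet.of_discrete) hA MeasurableSet.univ
    rw [Set.univ_inter, probReal_univ, one_mul] at key
    exact key
  · rw [if_neg hc, if_neg hc, mul_zero]

/-! ### 2. The law-comb tail, one chain gate longer -/

/-- `GTAIL[D+1, q] = (1 − q 0)·(units of level 0) + q 0 · GTAIL[D, q ∘ succ]` (levels shifted down). [this work] -/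
theorem gtail_succ (D : ℕ) (qc : ℕ → ℝ) (lv : κ → ℕ) (M : κ → ℕ) (μ : κ → ℕ → ℝ) (j : ℕ) :
    GTAIL[D + 1, qc, lv, M, μ, j] =
      (1 - qc 0) * (∑ c ∈ cfg[M], (∏ k, μ k (c k)) *
          (if j + 1 ≤ ∑ k ∈ Finset.univ.filter (fun k => lv k ≤ 0), c k then (1 : ℝ) else 0)) +
        qc 0 * GTAIL[D, (fun i => qc (i + 1)), (fun k => lv k - 1), M, μ, j] := by
  rw [Finset.sum_range_succ', add_comm]
  congr 1
  · have : pd[D + 1, qc, 0] = 1 - qc 0 := by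
      show (∏ i' ∈ Finset.range 0, qc i') * (if 0 < D + 1 then 1 - qc 0 else 1) = 1 - qc 0
      rw [Finset.prod_range_zero, one_mul, if_pos (Nat.succ_pos D)]
    rw [this]
  · rw [Finset.mul_sum]
    refine Finset.sum_congr rfl fun i hi => ?_
    have hpd : pd[D + 1, qc, i + 1] = qc 0 * pd[D, (fun i => qc (i + 1)), i] := by
      show (∏ i' ∈ Finset.range (i + 1), qc i') * (if i + 1 < D + 1 then 1 - qc (i + 1) else 1) =
        qc 0 * ((∏ i' ∈ Finset.range i, qc (i' + 1)) * (if i < D then 1 - qc (i + 1) else 1))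
      rw [Finset.prod_range_succ']
      by_cases hi' : i < D
      · rw [if_pos hi', if_pos (by omega)]; ring
      · rw [if_neg hi', if_neg (by omega)]; ring
    have hcnt : ∀ c : κ → ℕ, (∑ k ∈ Finset.univ.filter (fun k => lv k ≤ i + 1), c k) =
        ∑ k ∈ Finset.univ.filter (fun k => lv k - 1 ≤ i), c k := by
      intro c
      refine Finset.sum_congr ?_ fun _ _ => rfl
      ext k
      simp only [Finset.mem_filter, Finset.mem_univ, true_and]
      omega
    rw [hpd, mul_assoc]
    congr 1
    congr 1
    exact Finset.sum_congr rfl fun c _ => by rw [hcnt c]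

/-! ### 3. Identification of the relay count with the law-comb -/

/-- **Identification.**  Chain `ch : Fin D → E` (injective, off the units), units with pairwise disjoint gate sets `G k`, local counts `cnt k`
bounded by `M k`, levels `lv k ≤ D`: the probability that the reached units carry `≥ j+1` relays equals the law-comb tail with chain gates
`q (ch i)` and unit laws `h ↦ P(cnt k = h)`.  Induction on `D`, conditioning on the top chain gate. [this work] -/
theorem real_heavy_eq_gtail : ∀ (D : ℕ) (q : E → unitInterval) (ch : Fin D → E), Function.Injective ch →
    ∀ (G : κ → Finset E), (∀ k k', k ≠ k' → Disjoint (G k) (G k')) → (∀ k (i : Fin D), ch i ∉ G k) →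
    ∀ (cnt : κ → Set E → ℕ), (∀ k (ω ω' : Set E), (∀ e ∈ G k, e ∈ ω ↔ e ∈ ω') → cnt k ω = cnt k ω') →
    ∀ (M : κ → ℕ), (∀ k ω, cnt k ω ≤ M k) → ∀ (lv : κ → ℕ), (∀ k, lv k ≤ D) → ∀ (j : ℕ),
    (prodBernoulli q).real {ω : Set E | j + 1 ≤ ∑ k ∈ Finset.univ.filter
        (fun k => ∀ i : Fin D, (i : ℕ) < lv k → ch i ∈ ω), cnt k ω} =
      GTAIL[D, (fun i => if h : i < D then ((q (ch ⟨i, h⟩) : unitInterval) : ℝ) else 1), lv, M,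
        (fun k h => (prodBernoulli q).real {ω : Set E | cnt k ω = h}), j] := by
  intro D
  induction D with
  | zero =>
    intro q ch hch G hGdisj hGch cnt hloc M hbd lv hlv j
    have hlv0 : ∀ k, lv k = 0 := fun k => Nat.le_zero.1 (hlv k)
    have hev : {ω : Set E | j + 1 ≤ ∑ k ∈ Finset.univ.filter (fun k => ∀ i : Fin 0, (i : ℕ) < lv k → ch i ∈ ω), cnt k ω} =
        {ω : Set E | j + 1 ≤ ∑ k ∈ Finset.univ.filter (fun k => lv k ≤ 0), cnt k ω} := by
      ext ω
      simp only [Set.mem_setOf_eq]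
      have : Finset.univ.filter (fun k => ∀ i : Fin 0, (i : ℕ) < lv k → ch i ∈ ω) = Finset.univ.filter (fun k => lv k ≤ 0) := by
        ext k
        simp only [Finset.mem_filter, Finset.mem_univ, true_and, IsEmpty.forall_iff]
        exact ⟨fun _ => (hlv0 k).le, fun _ => trivial⟩
      rw [this]
    rw [hev, real_lawCount_eq_sum q G hGdisj cnt hloc M hbd lv 0 j, Finset.sum_range_one]
    have hpd : pd[0, (fun i => if h : i < 0 then ((q (ch ⟨i, h⟩) : unitInterval) : ℝ) else 1), 0] = 1 := by
      show (∏ i' ∈ Finset.range 0, (fun i => if h : i < 0 then ((q (ch ⟨i, h⟩) : unitInterval) : ℝ) else 1) i') *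
        (if 0 < 0 then 1 - (fun i => if h : i < 0 then ((q (ch ⟨i, h⟩) : unitInterval) : ℝ) else 1) 0 else (1 : ℝ)) = 1
      rw [Finset.prod_range_zero, if_neg (lt_irrefl 0), one_mul]
    rw [hpd, one_mul]
  | succ D ih =>
    intro q ch hch G hGdisj hGch cnt hloc M hbd lv hlv j
    set e₀ : E := ch 0 with he₀
    set H : Set (Set E) := {ω : Set E | j + 1 ≤ ∑ k ∈ Finset.univ.filter
        (fun k => ∀ i : Fin (D + 1), (i : ℕ) < lv k → ch i ∈ ω), cnt k ω} with hH
    have hch'inj : Function.Injective (fun i : Fin D => ch i.succ) := fun i i' h => Fin.succ_injective _ (hch h)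
    have hGch' : ∀ k (i : Fin D), (fun i : Fin D => ch i.succ) i ∉ G k := fun k i => hGch k i.succ
    have hlv' : ∀ k, (fun k => lv k - 1) k ≤ D := fun k => by have := hlv k; simp only; omega
    have he₀G : ∀ k, e₀ ∉ G k := fun k => hGch k 0
    have he₀ch' : ∀ i : Fin D, ch i.succ ≠ e₀ := fun i h => Fin.succ_ne_zero i (hch h)
    have hdet : DeterminedBy H (↑(Finset.univ : Finset E) : Set E) := by
      rw [determinedBy_iff]; intro ω ω' h
      simp only [Finset.coe_univ, Set.inter_univ] at h; rw [h]
    -- the local counts do not see the top chain gate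
    have hcins : ∀ k (ω : Set E), cnt k (insert e₀ ω) = cnt k ω := fun k ω =>
      hloc k _ _ fun e he => by
        rw [Set.mem_insert_iff]
        exact ⟨fun h => h.resolve_left (fun h' => he₀G k (h' ▸ he)), Or.inr⟩
    have hcdel : ∀ k (ω : Set E), cnt k (ω \ {e₀}) = cnt k ω := fun k ω =>
      hloc k _ _ fun e he => by
        rw [Set.mem_sdiff, Set.mem_singleton_iff]
        exact ⟨fun h => h.1, fun h => ⟨h, fun h' => he₀G k (h' ▸ he)⟩⟩
    -- top gate OPEN
    have hopen : {ω : Set E | insert e₀ ω ∈ H} = {ω : Set E | j + 1 ≤ ∑ k ∈ Finset.univ.filter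
        (fun k => ∀ i : Fin D, (i : ℕ) < lv k - 1 → ch i.succ ∈ ω), cnt k ω} := by
      ext ω
      simp only [hH, Set.mem_setOf_eq]
      have hC : ∀ k, (∀ i : Fin (D + 1), (i : ℕ) < lv k → ch i ∈ insert e₀ ω) ↔
          (∀ i : Fin D, (i : ℕ) < lv k - 1 → ch i.succ ∈ ω) := by
        intro k
        constructor
        · intro h i hi
          have hlt : ((i.succ : Fin (D + 1)) : ℕ) < lv k := by rw [Fin.val_succ]; omega
          rcases Set.mem_insert_iff.1 (h i.succ hlt) with h2 | h2
          · exact absurd h2 (he₀ch' i)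
          · exact h2
        · intro h i hi
          rcases Fin.eq_zero_or_eq_succ i with h0 | ⟨i', rfl⟩
          · rw [h0]; exact Set.mem_insert _ _
          · refine Set.mem_insert_of_mem _ (h i' ?_)
            have : ((i'.succ : Fin (D + 1)) : ℕ) = (i' : ℕ) + 1 := Fin.val_succ i'
            omega
      apply Iff.of_eq
      congr 1
      exact Finset.sum_congr (by ext k; simp only [Finset.mem_filter, Finset.mem_univ, true_and]; exact hC k)
        (fun k _ => hcins k ω)
    -- top gate CLOSED
    have hclosed : {ω : Set E | ω \ {e₀} ∈ H} =
        {ω : Set E | j + 1 ≤ ∑ k ∈ Finset.univ.filter (fun k => lv k ≤ 0), cnt k ω} := by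
      ext ω
      simp only [hH, Set.mem_setOf_eq]
      have hC : ∀ k, (∀ i : Fin (D + 1), (i : ℕ) < lv k → ch i ∈ ω \ {e₀}) ↔ lv k ≤ 0 := by
        intro k
        constructor
        · intro h
          by_contra hne
          have hlt : ((0 : Fin (D + 1)) : ℕ) < lv k := by simp only [Fin.val_zero]; omega
          exact (h 0 hlt).2 (Set.mem_singleton _)
        · intro h i hi; omega
      apply Iff.of_eq
      congr 1
      exact Finset.sum_congr (by ext k; simp only [Finset.mem_filter, Finset.mem_univ, true_and]; exact hC k)
        (fun k _ => hcdel k ω)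
    have hA : (prodBernoulli q).real {ω : Set E | insert e₀ ω ∈ H} =
        GTAIL[D, (fun i => if h : i < D then ((q (ch (Fin.succ ⟨i, h⟩)) : unitInterval) : ℝ) else 1), (fun k => lv k - 1), M,
          (fun k h => (prodBernoulli q).real {ω : Set E | cnt k ω = h}), j] := by
      rw [hopen]
      exact ih q (fun i : Fin D => ch i.succ) hch'inj G hGdisj hGch' cnt hloc M hbd (fun k => lv k - 1) hlv' j
    have hB : (prodBernoulli q).real {ω : Set E | ω \ {e₀} ∈ H} =
        ∑ c ∈ cfg[M], (∏ k, (prodBernoulli q).real {ω : Set E | cnt k ω = c k}) *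
          (if j + 1 ≤ ∑ k ∈ Finset.univ.filter (fun k => lv k ≤ 0), c k then (1 : ℝ) else 0) := by
      rw [hclosed]
      exact real_lawCount_eq_sum q G hGdisj cnt hloc M hbd lv 0 j
    have hsplit := prodBernoulli_real_gate_split q e₀ H
    rw [prodBernoulli_real_update_one_eq hdet q (Finset.mem_univ e₀),
      prodBernoulli_real_update_zero_eq hdet q (Finset.mem_univ e₀), hA, hB] at hsplit
    rw [hsplit]
    have hT := gtail_succ D (fun i => if h : i < D + 1 then ((q (ch ⟨i, h⟩) : unitInterval) : ℝ) else 1) lv M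
      (fun k h => (prodBernoulli q).real {ω : Set E | cnt k ω = h}) j
    have hchain : (fun i => if h : i + 1 < D + 1 then ((q (ch ⟨i + 1, h⟩) : unitInterval) : ℝ) else 1) =
        (fun i => if h : i < D then ((q (ch (Fin.succ ⟨i, h⟩)) : unitInterval) : ℝ) else 1) := by
      funext i
      by_cases h : i < D
      · have h' : i + 1 < D + 1 := Nat.succ_lt_succ h
        rw [dif_pos h', dif_pos h]
        rfl
      · have h' : ¬ (i + 1 < D + 1) := fun h'' => h (Nat.lt_of_succ_lt_succ h'')
        rw [dif_neg h', dif_neg h]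
    have hz : (⟨0, Nat.succ_pos D⟩ : Fin (D + 1)) = 0 := by ext; simp
    have hq0 : (if h : 0 < D + 1 then ((q (ch ⟨0, h⟩) : unitInterval) : ℝ) else 1) = ((q e₀ : unitInterval) : ℝ) := by
      rw [dif_pos (Nat.succ_pos D), hz]
    rw [hT, hchain, hq0]
    ring

/-! ### 4. FAR by mixture certificate, gate coordinates -/

/-- **FAR BY MIXTURE CERTIFICATE (gate coordinates).**  Independent gates `q`; chain `ch : Fin D → E` (injective); side units with pairwise
disjoint gate sets `G k` off the chain, local counts `cnt k ≤ M k`, levels `lv k`.  Suppose every unit law is a mixture of blob-family laws,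
`P(cnt k = h) = Σ_r λ k r · PB[sz k r, gt k r](h)`, with `λ ≥ 0`, `Σ_r λ k r = 1`, and for the genuine components (`λ k r > 0`): gates in
`[0,1]`, `Σ_l sz k r l ≤ M k`, live blobs at levels `≤ D` with `1 − (∏_{i<lv k} q(ch i))·gt k r l ≤ t`, and mean `Σ_l sz k r l·gt k r l = m k`.
If `2j < Σ_k (∏_{i<lv k} q(ch i))·m k` then `P(Σ_{k reached} cnt k ≤ j) ≤ t`. [this work] -/
theorem farTree_lawComb_of_mixture {ρ : Type*} [Fintype ρ] [DecidableEq ρ] (q : E → unitInterval) (D : ℕ) (ch : Fin D → E)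
    (hch : Function.Injective ch) (G : κ → Finset E) (hGdisj : ∀ k k', k ≠ k' → Disjoint (G k) (G k'))
    (hGch : ∀ k (i : Fin D), ch i ∉ G k) (cnt : κ → Set E → ℕ)
    (hloc : ∀ k (ω ω' : Set E), (∀ e ∈ G k, e ∈ ω ↔ e ∈ ω') → cnt k ω = cnt k ω')
    (M : κ → ℕ) (hbd : ∀ k ω, cnt k ω ≤ M k) (lv : κ → ℕ) (hlvD : ∀ k, lv k ≤ D)
    (lam : κ → ρ → ℝ) (sz : κ → ρ → β → ℕ) (gt : κ → ρ → β → ℝ) (m : κ → ℝ) (j : ℕ) (t : ℝ)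
    (hlam0 : ∀ k r, 0 ≤ lam k r) (hlam1 : ∀ k, ∑ r, lam k r = 1)
    (hμ : ∀ k h, (prodBernoulli q).real {ω : Set E | cnt k ω = h} = ∑ r, lam k r * PB[sz k r, gt k r, h])
    (hgt : ∀ k r, 0 < lam k r → ∀ l, 0 ≤ gt k r l ∧ gt k r l ≤ 1)
    (hM : ∀ k r, 0 < lam k r → ∑ l, sz k r l ≤ M k)
    (ht : ∀ k r, 0 < lam k r → ∀ l, 0 < sz k r l →
      1 - (∏ i ∈ Finset.range (lv k), (if h : i < D then ((q (ch ⟨i, h⟩) : unitInterval) : ℝ) else 1)) * gt k r l ≤ t)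
    (hmean : ∀ k r, 0 < lam k r → ∑ l, (sz k r l : ℝ) * gt k r l = m k)
    (hbudget : (2 * j : ℝ) < ∑ k, (∏ i ∈ Finset.range (lv k), (if h : i < D then ((q (ch ⟨i, h⟩) : unitInterval) : ℝ) else 1)) * m k) :
    (prodBernoulli q).real {ω : Set E | ∑ k ∈ Finset.univ.filter
        (fun k => ∀ i : Fin D, (i : ℕ) < lv k → ch i ∈ ω), cnt k ω ≤ j} ≤ t := by
  set H : Set (Set E) := {ω : Set E | j + 1 ≤ ∑ k ∈ Finset.univ.filter
        (fun k => ∀ i : Fin D, (i : ℕ) < lv k → ch i ∈ ω), cnt k ω} with hH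
  have hcompl : {ω : Set E | ∑ k ∈ Finset.univ.filter
        (fun k => ∀ i : Fin D, (i : ℕ) < lv k → ch i ∈ ω), cnt k ω ≤ j} = Hᶜ := by
    ext ω; simp only [hH, Set.mem_setOf_eq, Set.mem_compl_iff, not_le]; omega
  have hheavy := real_heavy_eq_gtail D q ch hch G hGdisj hGch cnt hloc M hbd lv hlvD j
  rw [hcompl, probReal_compl_eq_one_sub MeasurableSet.of_discrete, hheavy]
  set qc : ℕ → ℝ := fun i => if h : i < D then ((q (ch ⟨i, h⟩) : unitInterval) : ℝ) else 1 with hqc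
  have hqc01 : ∀ i, 0 ≤ qc i ∧ qc i ≤ 1 := fun i => by
    by_cases h : i < D
    · simp only [hqc, dif_pos h]; exact ⟨(q _).2.1, (q _).2.2⟩
    · simp only [hqc, dif_neg h]; norm_num
  have hx : ∀ k r, 0 < lam k r → ∀ l, 0 < sz k r l → 1 - t ≤ (∏ i ∈ Finset.range (lv k), qc i) * gt k r l :=
    fun k r hr l hl => by have := ht k r hr l hl; linarith
  have key := LawComb.tail_ge_of_mixture D qc hqc01 lv M (fun k h => (prodBernoulli q).real {ω : Set E | cnt k ω = h}) lam sz gt m j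
    (1 - t) hlam0 hlam1 hμ hgt hM (fun k r hr l _ => hlvD k) hx hmean hbudget
  linarith

end LawCombGate

end Quant

end Summit.CriticalPhenomena.PercolationContinuityZ3.Theorems
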